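import Mathlib
import Summits.KontsevichZagierPeriods.Zeta5Search.TypeSpaceLawZeroProof
import Summits.KontsevichZagierPeriods.Zeta5Search.ConstantTermFloorWindow
import Summits.KontsevichZagierPeriods.Zeta5Search.PhiHatConjugation
import HarnessLib

/-!
# ζ(5) search — the type-space law, ORIGIN regime: aggregation `(W/(−p)^{m+3}, V/(−p)^m) ≡ A − p·Σ_z k_z P_z (mod p²)`

HONEST FRAMING: systematic search; no irrationality claim unless certified.

Cell `pub-zeta5`, prover seat p3 (gen 2), on typer g11's machinery (`TypeSpaceAggregate`, `SecondOrderPair`, `TypeSpacePoints`).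
REPORT-gen2-g11 §4.1 WITHOUT the palindromic (zero-regime) hypothesis: for `M ≥ 6` even, pole classes of exponent `≥ −M`, classes of
exponent `−M` not containing the centre, there are `p`-integral `X, Y`, weights `k_z` on the live classes (`ĝφ/4` deep, `ĝ/4` sub-deep,
`4Σ k = Res₀`) and FIRST-ORDER weights `c_x = ½ĝ_x(1 − ½pL_xφ_x)` on the deep classes with
`W/(−p)^{3−M} = A_W − pX + O(p²)`, `V/(−p)^{−M} = A_V − pY + O(p²)`, `(X, Y) ≡ Σ_z k_z P_z (mod p)`,
`A_W = Σ_{deep x} c_x(ŵ_x − ŵ_x̄)`, `A_V = Σ_{deep x} c_x(v̂_x − v̂_x̄)` (`aggregateOrigin`).  The new input relative to `aggregate₃` is the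
conjugation of `φ`: `‖φ_x̄ + φ_x‖ ≤ p⁻¹` (`phiHat_conj_add`, reflection `s ↦ b₀ − s` of the foreign factors).  In the zero regime `A = 0`
and this is `aggregate₃`; in the origin regime (`σ_x − σ_x̄ ∈ ℚ·u`) `A ∥ u`.  Nothing here bears on irrationality.
-/

noncomputable section

open Finset

namespace Summit.KontsevichZagierPeriods.Zeta5Search.SecondOrder

open Summit.KontsevichZagierPeriods.Zeta5Search.DualSeries (InBox)
open Summit.KontsevichZagierPeriods.Zeta5Search.WedgeDictionary (coeffW coeffV)
open Summit.KontsevichZagierPeriods.Zeta5Search.CasoratianValuation (InPolytope)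
open Summit.KontsevichZagierPeriods.Zeta5Search.ClusterValuation
open Summit.KontsevichZagierPeriods.Zeta5Search.PadicSeries
open Summit.KontsevichZagierPeriods.Zeta5Search.CellA (classW coeffW_eq_sum_classW padicNorm_p)
open Summit.KontsevichZagierPeriods.Zeta5Search.ResidueLaw (pointW pointV liveClasses)

variable {p : ℕ} [hp : Fact p.Prime]

/-! ## Aggregation in the origin regime -/

section Agg

variable (b : ℕ → ℤ) (hb : InPolytope b) (hp5 : 5 ≤ p) (hpn : (p : ℤ) ≤ b 0) (hwin : (b 0 + 2 : ℤ) < (p : ℤ) ^ 2)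
  {M : ℕ} (hM : 6 ≤ M) (hMe : Even M)
  (G1 : ∀ x, x < p → 1 ≤ classPoleCount b p x → -(M : ℤ) ≤ classExp b p x)
  (G3' : ∀ x, x < p → 1 ≤ classPoleCount b p x → classExp b p x = -(M : ℤ) → ¬ CentreIn b p x)
include hb hp5 hpn hwin hM hMe G1 G3'

/-- **AGGREGATION for the type-space law WITHOUT the palindromic hypothesis (origin regime).**  `p`-integral `X, Y`, first-order weights
`c_x` on the classes of exponent `−M` and weights `k_z` on the live classes with
`W/(−p)^{3−M} = Σ_x c_x(ŵ_x − ŵ_x̄) − pX + O(p²)`, `V/(−p)^{−M} = Σ_x c_x(v̂_x − v̂_x̄) − pY + O(p²)`,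
`(X, Y) ≡ Σ_z k_z P_z (mod p)` and `4Σ_z k_z = Σ_{deep} ĝφ + Σ_{sub-deep} ĝ`. -/
theorem aggregateOrigin : ∃ X Y : ℚ, ∃ c k : ℕ → ℚ, padicNorm p X ≤ 1 ∧ padicNorm p Y ≤ 1 ∧
    (∀ z, padicNorm p (c z) ≤ 1) ∧ (∀ z, c z ≠ 0 → z < p ∧ 1 ≤ classPoleCount b p z ∧ classExp b p z = -(M : ℤ)) ∧
    padicNorm p (coeffW b / (-(p : ℚ)) ^ (-(M : ℤ) + 3)
      - (∑ z ∈ range p, c z * (wHat b p z - wHat b p (conjClass b p z))) + (p : ℚ) * X) ≤ (p : ℚ) ^ (-(2 : ℤ)) ∧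
    padicNorm p (coeffV b / (-(p : ℚ)) ^ (-(M : ℤ))
      - (∑ z ∈ range p, c z * (vHat b p z - vHat b p (conjClass b p z))) + (p : ℚ) * Y) ≤ (p : ℚ) ^ (-(2 : ℤ)) ∧
    (∀ z, padicNorm p (k z) ≤ 1) ∧ (∀ z, k z ≠ 0 → z ∈ liveClasses b p M) ∧
    4 * ∑ z ∈ range p, k z =
      (∑ z ∈ (range p).filter (fun x => 1 ≤ classPoleCount b p x ∧ classExp b p x = -(M : ℤ)), gHat b p z * phiHat b p z)
        + ∑ z ∈ (range p).filter (fun x => 1 ≤ classPoleCount b p x ∧ classExp b p x = -(M : ℤ) + 1), gHat b p z ∧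
    padicNorm p (X - ∑ z ∈ range p, k z * pointW b p M z) ≤ (p : ℚ) ^ (-(1 : ℤ)) ∧
    padicNorm p (Y - ∑ z ∈ range p, k z * pointV b p M z) ≤ (p : ℚ) ^ (-(1 : ℤ)) := by
  have h0 : 0 ≤ b 0 := hb.1.1
  have hp0 : 0 < p := hp.out.pos
  have hp2 : p ≠ 2 := by omega
  have hpQ : (p : ℚ) ≠ 0 := Nat.cast_ne_zero.2 hp.out.ne_zero
  obtain ⟨-, -, -, hn⟩ := thmA_data b hb hwin
  have hpn' : p ≤ (b 0).toNat := by omega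
  have h2n : padicNorm p (2 : ℚ) = 1 := padicNorm_two hp2
  have h4n : padicNorm p (4 : ℚ) = 1 := by rw [show (4 : ℚ) = 2 * 2 by norm_num, padicNorm.mul, h2n, one_mul]
  have hhalf : padicNorm p ((1 : ℚ) / 2) = 1 := by rw [padicNorm.div, padicNorm.one, h2n, div_one]
  have hquart : padicNorm p ((1 : ℚ) / 4) = 1 := by rw [padicNorm.div, padicNorm.one, h4n, div_one]
  have hpn1 : padicNorm p (p : ℚ) = (p : ℚ) ^ (-(1 : ℤ)) := padicNorm_p
  set m : ℤ := -(M : ℤ) with hm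
  set D := (range p).filter (fun x => 1 ≤ classPoleCount b p x ∧ classExp b p x = m) with hD
  set S := (range p).filter (fun y => 1 ≤ classPoleCount b p y ∧ classExp b p y = m + 1) with hS
  have hDsub : D ⊆ range p := filter_subset _ _
  have hSsub : S ⊆ range p := filter_subset _ _
  -- integrality of the ingredients
  have hg1 : ∀ x, x < p → padicNorm p (gHat b p x) ≤ 1 := fun x hx =>
    LevelClass.padicNorm_gHat_le_one b hb hp5 hx
      (mem_filter.2 ⟨mem_range.2 (by have := le_b0_of_lt b hpn hx; omega), rfl⟩)
  have hφ1 : ∀ x, padicNorm p (phiHat b p x) ≤ 1 := fun x => padicNorm_phiHat_le_one b hp2 x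
  have hw1 : ∀ z, padicNorm p (wHat b p z) ≤ 1 := fun z => LevelClass.padicNorm_wHat_le_one b h0 hn hp2 z
  have hv1 : ∀ z, padicNorm p (vHat b p z) ≤ 1 := fun z => LevelClass.padicNorm_vHat_le_one b h0 hn hp2
  have hw21 : ∀ z, padicNorm p (wHat2 b p z) ≤ 1 := fun z => padicNorm_wHat2_le_one b h0 hn hp2 z
  have hv21 : ∀ z, padicNorm p (vHat2 b p z) ≤ 1 := fun z => padicNorm_vHat2_le_one b h0 hn hp2 z
  have hτ1 : ∀ z, padicNorm p (tauW b p z) ≤ 1 ∧ padicNorm p (tauV b p z) ≤ 1 := fun z => padicNorm_tau_le_one b h0 hn hp2 z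
  have hP1 : ∀ z, padicNorm p (pointW b p M z) ≤ 1 ∧ padicNorm p (pointV b p M z) ≤ 1 := fun z =>
    padicNorm_point_le_one b h0 hn hp2 M z
  have hL1 : ∀ z, padicNorm p ((topLevel b p z : ℕ) : ℚ) ≤ 1 := fun z => by simpa using padicNorm.of_nat (p := p) (topLevel b p z)
  -- ### deep classes
  have hDmem : ∀ x ∈ D, x < p ∧ 1 ≤ classPoleCount b p x ∧ classExp b p x = m := fun x hx => by
    obtain ⟨hxr, h⟩ := mem_filter.1 hx; exact ⟨mem_range.1 hxr, h⟩
  have hDconj : ∀ x ∈ D, conjClass b p x ∈ D := fun x hx =>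
    conj_mem_filter b h0 hp0 hpn' (P := fun c E => 1 ≤ c ∧ E = m) hx
  have hSconj : ∀ y ∈ S, conjClass b p y ∈ S := fun y hy =>
    conj_mem_filter b h0 hp0 hpn' (P := fun c E => 1 ≤ c ∧ E = m + 1) hy
  -- the first-order weights
  set cval : ℕ → ℚ := fun x => gHat b p x * (1 - (topLevel b p x : ℚ) * p * phiHat b p x / 2) / 2 with hcval
  set c : ℕ → ℚ := fun x => if x ∈ D then cval x else 0 with hc
  have hcD : ∀ x ∈ D, c x = cval x := fun x hx => by simp only [hc, if_pos hx]
  have hc0 : ∀ x, x ∉ D → c x = 0 := fun x hx => by simp only [hc, if_neg hx]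
  -- ### the per-class models (as in `aggregate₃`)
  set MW : ℕ → ℚ := fun x =>
    (if x ∈ D then gHat b p x * (wHat b p x - (p : ℚ) * phiHat b p x * wHat2 b p x) else 0)
      + (if x ∈ S then -((p : ℚ) * gHat b p x * wHat b p x) else 0) with hMW
  set MV : ℕ → ℚ := fun x =>
    (if x ∈ D then gHat b p x * (vHat b p x - (p : ℚ) * phiHat b p x * vHat2 b p x) else 0)
      + (if x ∈ S then -((p : ℚ) * gHat b p x * vHat b p x) else 0) with hMV
  have hclass : ∀ x ∈ range p,
      padicNorm p (classW b p x / (-(p : ℚ)) ^ (m + 3) - MW x) ≤ (p : ℚ) ^ (-(2 : ℤ)) ∧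
      padicNorm p (classV b p x / (-(p : ℚ)) ^ m - MV x) ≤ (p : ℚ) ^ (-(2 : ℤ)) := by
    intro x hxr
    have hxp := mem_range.1 hxr
    by_cases hxD : x ∈ D
    · obtain ⟨-, h1, hE⟩ := hDmem x hxD
      have hxS : x ∉ S := fun h => by have := (mem_filter.1 h).2.2; omega
      have e1 : MW x = gHat b p x * (wHat b p x - (p : ℚ) * phiHat b p x * wHat2 b p x) := by
        simp only [hMW, if_pos hxD, if_neg hxS, add_zero]
      have e2 : MV x = gHat b p x * (vHat b p x - (p : ℚ) * phiHat b p x * vHat2 b p x) := by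
        simp only [hMV, if_pos hxD, if_neg hxS, add_zero]
      rw [e1, e2, ← hE]
      exact ⟨deepW_norm b hb hp5 hwin hxp h1, deepV_norm b hb hp5 hwin hxp h1 (by omega)⟩
    by_cases hxS : x ∈ S
    · obtain ⟨-, h1, hE⟩ := mem_filter.1 hxS
      have e1 : MW x = -((p : ℚ) * gHat b p x * wHat b p x) := by simp only [hMW, if_neg hxD, if_pos hxS, zero_add]
      have e2 : MV x = -((p : ℚ) * gHat b p x * vHat b p x) := by simp only [hMV, if_neg hxD, if_pos hxS, zero_add]
      rw [e1, e2, sub_neg_eq_add, sub_neg_eq_add]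
      exact ⟨subW_norm b hb hp5 hwin hxp h1 hE, subV_norm b hb hp5 hwin hxp h1 hE⟩
    · have e1 : MW x = 0 := by simp only [hMW, if_neg hxD, if_neg hxS, add_zero]
      have e2 : MV x = 0 := by simp only [hMV, if_neg hxD, if_neg hxS, add_zero]
      rw [e1, e2, sub_zero, sub_zero]
      have hrestE : 1 ≤ classPoleCount b p x → m + 2 ≤ classExp b p x := by
        intro h1
        have hge := G1 x hxp h1
        have hne1 : classExp b p x ≠ m := fun h => hxD (mem_filter.2 ⟨hxr, h1, h⟩)
        have hne2 : classExp b p x ≠ m + 1 := fun h => hxS (mem_filter.2 ⟨hxr, h1, h⟩)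
        omega
      exact ⟨restW_norm b hb hp5 hwin (by omega) fun h2 => hrestE (by omega),
        restV_norm b hb hp5 hwin hxp fun h1 => (hrestE h1).trans (CellA.classExp_le_classNu b p x)⟩
  -- ### the sums `X, Y`
  set X := (∑ x ∈ D, gHat b p x * phiHat b p x / 4 * pointW b p M x) + ∑ y ∈ S, gHat b p y * wHat b p y with hX
  set Y := (∑ x ∈ D, gHat b p x * phiHat b p x / 4 * pointV b p M x) + ∑ y ∈ S, gHat b p y * vHat b p y with hY
  -- ### the deep remainders `F` and their conjugate pairing
  set FW : ℕ → ℚ := fun x => gHat b p x * (wHat b p x - (p : ℚ) * phiHat b p x * wHat2 b p x)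
    + (p : ℚ) * (gHat b p x * phiHat b p x / 4 * pointW b p M x) - cval x * (wHat b p x - wHat b p (conjClass b p x)) with hFW
  set FV : ℕ → ℚ := fun x => gHat b p x * (vHat b p x - (p : ℚ) * phiHat b p x * vHat2 b p x)
    + (p : ℚ) * (gHat b p x * phiHat b p x / 4 * pointV b p M x) - cval x * (vHat b p x - vHat b p (conjClass b p x)) with hFV
  have hpair : ∀ x ∈ D, padicNorm p (FW x + FW (conjClass b p x)) ≤ (p : ℚ) ^ (-(2 : ℤ)) ∧
      padicNorm p (FV x + FV (conjClass b p x)) ≤ (p : ℚ) ^ (-(2 : ℤ)) := by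
    intro x hx
    obtain ⟨hxp, h1, hE⟩ := hDmem x hx
    exact deep_pair_remainder b hb hp5 hpn hwin hMe hxp hE (G3' x hxp h1 hE)
  -- ### the weights `k` (as in `aggregate₃`)
  set k : ℕ → ℚ := fun z => (if z ∈ D then gHat b p z * phiHat b p z / 4 else 0)
    + (if z ∈ S then gHat b p z / 4 else 0) with hk
  have hkD : ∀ z ∈ D, k z = gHat b p z * phiHat b p z / 4 := fun z hz => by
    have hzS : z ∉ S := fun h => by have := (mem_filter.1 h).2.2; have := (hDmem z hz).2.2; omega
    simp only [hk, if_pos hz, if_neg hzS, add_zero]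
  have hkS : ∀ z ∈ S, k z = gHat b p z / 4 := fun z hz => by
    have hzD : z ∉ D := fun h => by have := (mem_filter.1 hz).2.2; have := (hDmem z h).2.2; omega
    simp only [hk, if_neg hzD, if_pos hz, zero_add]
  have hk0 : ∀ z, z ∉ D → z ∉ S → k z = 0 := fun z hzD hzS => by simp only [hk, if_neg hzD, if_neg hzS, add_zero]
  have hksum : ∀ f : ℕ → ℚ, ∑ z ∈ range p, k z * f z =
      (∑ z ∈ D, gHat b p z * phiHat b p z / 4 * f z) + ∑ z ∈ S, gHat b p z / 4 * f z := by
    intro f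
    rw [← sum_ite_mem_subset hDsub, ← sum_ite_mem_subset hSsub, ← sum_add_distrib]
    refine sum_congr rfl fun z _ => ?_
    simp only [hk]; split_ifs <;> ring
  have hSpair : padicNorm p ((∑ y ∈ S, gHat b p y * wHat b p y) - ∑ y ∈ S, gHat b p y / 4 * pointW b p M y)
        ≤ (p : ℚ) ^ (-(1 : ℤ)) ∧
      padicNorm p ((∑ y ∈ S, gHat b p y * vHat b p y) - ∑ y ∈ S, gHat b p y / 4 * pointV b p M y)
        ≤ (p : ℚ) ^ (-(1 : ℤ)) := by
    have hSp : ∀ y ∈ S, y < p := fun y hy => mem_range.1 (hSsub hy)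
    have key : ∀ F G : ℕ → ℚ, (∀ y ∈ S, padicNorm p ((F y + F (conjClass b p y)) - (G y + G (conjClass b p y)))
        ≤ (p : ℚ) ^ (-(1 : ℤ))) → padicNorm p ((∑ y ∈ S, F y) - ∑ y ∈ S, G y) ≤ (p : ℚ) ^ (-(1 : ℤ)) := by
      intro F G hFG
      have e : (∑ y ∈ S, F y) - ∑ y ∈ S, G y = (1 : ℚ) / 2 * ((2 * ∑ y ∈ S, F y) - 2 * ∑ y ∈ S, G y) := by ring
      rw [e, padicNorm.mul, hhalf, one_mul, sum_conj_symm b hpn' S hSp hSconj F, sum_conj_symm b hpn' S hSp hSconj G,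
        ← sum_sub_distrib]
      exact padicNorm.sum_le' hFG (zpow_p_nonneg _)
    constructor
    · refine key _ _ fun y hy => ?_
      obtain ⟨hyr, -, hE⟩ := mem_filter.1 hy
      exact (sub_pair_point b hb hp5 hpn hwin hMe (mem_range.1 hyr) hE).1
    · refine key _ _ fun y hy => ?_
      obtain ⟨hyr, -, hE⟩ := mem_filter.1 hy
      exact (sub_pair_point b hb hp5 hpn hwin hMe (mem_range.1 hyr) hE).2
  -- ### the deep sums are `O(p²)`
  have hDp : ∀ y ∈ D, y < p := fun y hy => (hDmem y hy).1
  have hFWsum : padicNorm p (∑ x ∈ D, FW x) ≤ (p : ℚ) ^ (-(2 : ℤ)) := by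
    have e : ∑ x ∈ D, FW x = (1 : ℚ) / 2 * (2 * ∑ x ∈ D, FW x) := by ring
    rw [e, padicNorm.mul, hhalf, one_mul, sum_conj_symm b hpn' D hDp hDconj FW]
    exact padicNorm.sum_le' (fun x hx => (hpair x hx).1) (zpow_p_nonneg _)
  have hFVsum : padicNorm p (∑ x ∈ D, FV x) ≤ (p : ℚ) ^ (-(2 : ℤ)) := by
    have e : ∑ x ∈ D, FV x = (1 : ℚ) / 2 * (2 * ∑ x ∈ D, FV x) := by ring
    rw [e, padicNorm.mul, hhalf, one_mul, sum_conj_symm b hpn' D hDp hDconj FV]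
    exact padicNorm.sum_le' (fun x hx => (hpair x hx).2) (zpow_p_nonneg _)
  -- ### sums of the models
  have hcsumW : ∑ z ∈ range p, c z * (wHat b p z - wHat b p (conjClass b p z))
      = ∑ z ∈ D, cval z * (wHat b p z - wHat b p (conjClass b p z)) := by
    rw [← sum_ite_mem_subset hDsub]
    refine sum_congr rfl fun z _ => ?_
    split_ifs with h
    · rw [hcD z h]
    · rw [hc0 z h, zero_mul]
  have hcsumV : ∑ z ∈ range p, c z * (vHat b p z - vHat b p (conjClass b p z))
      = ∑ z ∈ D, cval z * (vHat b p z - vHat b p (conjClass b p z)) := by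
    rw [← sum_ite_mem_subset hDsub]
    refine sum_congr rfl fun z _ => ?_
    split_ifs with h
    · rw [hcD z h]
    · rw [hc0 z h, zero_mul]
  have hSW : ∑ x ∈ range p, MW x + (p : ℚ) * X - ∑ z ∈ D, cval z * (wHat b p z - wHat b p (conjClass b p z))
      = ∑ x ∈ D, FW x := by
    have eMW : ∑ x ∈ range p, MW x = (∑ x ∈ D, gHat b p x * (wHat b p x - (p : ℚ) * phiHat b p x * wHat2 b p x))
        + ∑ y ∈ S, -((p : ℚ) * gHat b p y * wHat b p y) := by
      rw [hMW, sum_add_distrib, sum_ite_mem_subset hDsub, sum_ite_mem_subset hSsub]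
    have hS0 : (∑ y ∈ S, -((p : ℚ) * gHat b p y * wHat b p y)) + (p : ℚ) * ∑ y ∈ S, gHat b p y * wHat b p y = 0 := by
      rw [Finset.mul_sum, ← sum_add_distrib]
      exact sum_eq_zero fun y _ => by ring
    have hD1 : ∑ x ∈ D, FW x = (∑ x ∈ D, gHat b p x * (wHat b p x - (p : ℚ) * phiHat b p x * wHat2 b p x))
        + (p : ℚ) * (∑ x ∈ D, gHat b p x * phiHat b p x / 4 * pointW b p M x)
        - ∑ z ∈ D, cval z * (wHat b p z - wHat b p (conjClass b p z)) := by
      rw [Finset.mul_sum, ← sum_add_distrib, ← sum_sub_distrib]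
    rw [eMW, hX, hD1, mul_add]
    linear_combination hS0
  have hSV : ∑ x ∈ range p, MV x + (p : ℚ) * Y - ∑ z ∈ D, cval z * (vHat b p z - vHat b p (conjClass b p z))
      = ∑ x ∈ D, FV x := by
    have eMV : ∑ x ∈ range p, MV x = (∑ x ∈ D, gHat b p x * (vHat b p x - (p : ℚ) * phiHat b p x * vHat2 b p x))
        + ∑ y ∈ S, -((p : ℚ) * gHat b p y * vHat b p y) := by
      rw [hMV, sum_add_distrib, sum_ite_mem_subset hDsub, sum_ite_mem_subset hSsub]
    have hS0 : (∑ y ∈ S, -((p : ℚ) * gHat b p y * vHat b p y)) + (p : ℚ) * ∑ y ∈ S, gHat b p y * vHat b p y = 0 := by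
      rw [Finset.mul_sum, ← sum_add_distrib]
      exact sum_eq_zero fun y _ => by ring
    have hD1 : ∑ x ∈ D, FV x = (∑ x ∈ D, gHat b p x * (vHat b p x - (p : ℚ) * phiHat b p x * vHat2 b p x))
        + (p : ℚ) * (∑ x ∈ D, gHat b p x * phiHat b p x / 4 * pointV b p M x)
        - ∑ z ∈ D, cval z * (vHat b p z - vHat b p (conjClass b p z)) := by
      rw [Finset.mul_sum, ← sum_add_distrib, ← sum_sub_distrib]
    rw [eMV, hY, hD1, mul_add]
    linear_combination hS0
  refine ⟨X, Y, c, k, ?_, ?_, ?_, ?_, ?_, ?_, ?_, ?_, ?_, ?_, ?_⟩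
  · -- `X` is integral
    rw [hX]
    refine (padicNorm.nonarchimedean (p := p)).trans (max_le ?_ ?_)
    · refine padicNorm.sum_le' (fun x hx => ?_) zero_le_one
      rw [padicNorm.mul, padicNorm.div, h4n, div_one, padicNorm.mul]
      calc _ ≤ (1 : ℚ) * 1 * 1 := mul_le_mul (mul_le_mul (hg1 x (hDmem x hx).1) (hφ1 x) (padicNorm.nonneg _) zero_le_one)
            (hP1 x).1 (padicNorm.nonneg _) (by norm_num)
        _ = 1 := by ring
    · refine padicNorm.sum_le' (fun y hy => ?_) zero_le_one
      rw [padicNorm.mul]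
      calc _ ≤ (1 : ℚ) * 1 := mul_le_mul (hg1 y (mem_range.1 (hSsub hy))) (hw1 y) (padicNorm.nonneg _) zero_le_one
        _ = 1 := one_mul _
  · -- `Y` is integral
    rw [hY]
    refine (padicNorm.nonarchimedean (p := p)).trans (max_le ?_ ?_)
    · refine padicNorm.sum_le' (fun x hx => ?_) zero_le_one
      rw [padicNorm.mul, padicNorm.div, h4n, div_one, padicNorm.mul]
      calc _ ≤ (1 : ℚ) * 1 * 1 := mul_le_mul (mul_le_mul (hg1 x (hDmem x hx).1) (hφ1 x) (padicNorm.nonneg _) zero_le_one)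
            (hP1 x).2 (padicNorm.nonneg _) (by norm_num)
        _ = 1 := by ring
    · refine padicNorm.sum_le' (fun y hy => ?_) zero_le_one
      rw [padicNorm.mul]
      calc _ ≤ (1 : ℚ) * 1 := mul_le_mul (hg1 y (mem_range.1 (hSsub hy))) (hv1 y) (padicNorm.nonneg _) zero_le_one
        _ = 1 := one_mul _
  · -- `‖c z‖ ≤ 1`
    intro z
    by_cases hz : z ∈ D
    · rw [hcD z hz, hcval, padicNorm.div, h2n, div_one, padicNorm.mul]
      have hin : padicNorm p (1 - (topLevel b p z : ℚ) * p * phiHat b p z / 2) ≤ 1 := by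
        refine (padicNorm.sub (p := p)).trans (max_le (by rw [padicNorm.one]) ?_)
        rw [padicNorm.div, h2n, div_one, padicNorm.mul, padicNorm.mul, hpn1]
        have hp1 : (p : ℚ) ^ (-(1 : ℤ)) ≤ 1 := zpow_le_one_of_nonpos₀ (by exact_mod_cast hp.out.one_lt.le) (by norm_num)
        have e1 : padicNorm p ((topLevel b p z : ℕ) : ℚ) * (p : ℚ) ^ (-(1 : ℤ)) ≤ 1 * 1 :=
          mul_le_mul (hL1 z) hp1 (zpow_p_nonneg _) zero_le_one
        calc padicNorm p ((topLevel b p z : ℕ) : ℚ) * (p : ℚ) ^ (-(1 : ℤ)) * padicNorm p (phiHat b p z) ≤ 1 * 1 * 1 :=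
              mul_le_mul e1 (hφ1 z) (padicNorm.nonneg _) (by positivity)
          _ = 1 := by ring
      calc _ ≤ (1 : ℚ) * 1 := mul_le_mul (hg1 z (hDmem z hz).1) hin (padicNorm.nonneg _) zero_le_one
        _ = 1 := one_mul _
    · rw [hc0 z hz, padicNorm.zero]; exact zero_le_one
  · -- support of `c`
    intro z hz
    by_cases hzD : z ∈ D
    · exact hDmem z hzD
    · exact absurd (hc0 z hzD) hz
  · -- `W`
    have e : coeffW b / (-(p : ℚ)) ^ (-(M : ℤ) + 3)
        - (∑ z ∈ range p, c z * (wHat b p z - wHat b p (conjClass b p z))) + (p : ℚ) * X =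
        (∑ x ∈ range p, (classW b p x / (-(p : ℚ)) ^ (m + 3) - MW x))
          + (∑ x ∈ range p, MW x + (p : ℚ) * X - ∑ z ∈ D, cval z * (wHat b p z - wHat b p (conjClass b p z))) := by
      rw [hcsumW, sum_sub_distrib, coeffW_eq_sum_classW b hp0, sum_div]; ring
    rw [e, hSW]
    exact (padicNorm.nonarchimedean (p := p)).trans
      (max_le (padicNorm.sum_le' (fun x hx => (hclass x hx).1) (zpow_p_nonneg _)) hFWsum)
  · -- `V`
    have e : coeffV b / (-(p : ℚ)) ^ (-(M : ℤ))
        - (∑ z ∈ range p, c z * (vHat b p z - vHat b p (conjClass b p z))) + (p : ℚ) * Y =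
        (∑ x ∈ range p, (classV b p x / (-(p : ℚ)) ^ m - MV x))
          + (∑ x ∈ range p, MV x + (p : ℚ) * Y - ∑ z ∈ D, cval z * (vHat b p z - vHat b p (conjClass b p z))) := by
      rw [hcsumV, sum_sub_distrib, coeffV_eq_sum_classV b hp0, sum_div]; ring
    rw [e, hSV]
    exact (padicNorm.nonarchimedean (p := p)).trans
      (max_le (padicNorm.sum_le' (fun x hx => (hclass x hx).2) (zpow_p_nonneg _)) hFVsum)
  · -- `‖k_z‖ ≤ 1`
    intro z
    by_cases hzD : z ∈ D
    · rw [hkD z hzD, padicNorm.div, h4n, div_one, padicNorm.mul]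
      calc _ ≤ (1 : ℚ) * 1 := mul_le_mul (hg1 z (hDmem z hzD).1) (hφ1 z) (padicNorm.nonneg _) zero_le_one
        _ = 1 := one_mul _
    by_cases hzS : z ∈ S
    · rw [hkS z hzS, padicNorm.div, h4n, div_one]; exact hg1 z (mem_range.1 (hSsub hzS))
    · rw [hk0 z hzD hzS, padicNorm.zero]; exact zero_le_one
  · -- support of `k`
    intro z hz
    by_cases hzD : z ∈ D
    · obtain ⟨hzp, h1, hE⟩ := hDmem z hzD
      exact mem_filter.2 ⟨mem_range.2 hzp, h1, Or.inl hE⟩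
    by_cases hzS : z ∈ S
    · obtain ⟨hzr, h1, hE⟩ := mem_filter.1 hzS
      exact mem_filter.2 ⟨hzr, h1, Or.inr hE⟩
    · exact absurd (hk0 z hzD hzS) hz
  · -- `4Σk = Σ_D ĝφ + Σ_S ĝ`
    have := hksum fun _ => 1
    simp only [mul_one] at this
    rw [this, mul_add, Finset.mul_sum, Finset.mul_sum]
    congr 1
    · exact sum_congr rfl fun z _ => by ring
    · exact sum_congr rfl fun z _ => by ring
  · -- `X − Σ k·P_W = Σ_S ĝŵ − Σ_S (ĝ/4)P_W`
    have e : X - ∑ z ∈ range p, k z * pointW b p M z =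
        (∑ y ∈ S, gHat b p y * wHat b p y) - ∑ y ∈ S, gHat b p y / 4 * pointW b p M y := by
      rw [hksum, hX]; ring
    rw [e]; exact hSpair.1
  · have e : Y - ∑ z ∈ range p, k z * pointV b p M z =
        (∑ y ∈ S, gHat b p y * vHat b p y) - ∑ y ∈ S, gHat b p y / 4 * pointV b p M y := by
      rw [hksum, hY]; ring
    rw [e]; exact hSpair.2

end Agg

end Summit.KontsevichZagierPeriods.Zeta5Search.SecondOrder
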